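import Mathlib
import HarnessLib
import Summits.NavierStokesRegularity.NavierStokesRegularity.Theorems.PoloidalWindowDoorLrcModEntireTwistingTHFlatRidgeQuarticNormalForm

/-!
# Item `LrcModEntire` (stmt-NavierStokesRegularity-20428) — THE FLAT SUB-CELL: the transversal binary QUARTIC FORM at a flat hot point is explicit and SIGNED; `μ₀ = 0 ⇒ b = 0`

ns-k2-port-2 g7, helper of item 20428 (LEAD lineage ns-poloidal-K2-p3; `--supports stmt-NavierStokesRegularity-20428 --as helper`).  Memo `Cruxes/LrcModEntire/T2B-g15.md` §17b/§17e:
with `θ = v₂(−1,·)`, a flat hot point `y ∈ P₀`, the secant direction `T`, `ν = JT`, the slope `μ₀ ≤ 0` (`c₀ = −μ₀`), `P := D⁴θ(y)[ν,ν,ν,ν]`, `B₃ := D⁴θ(y)[ν,e₂,ν,ν]`: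

* `iteratedDeriv_four_line_eq` — `(d⁴/ds⁴)|₀ θ(y + sh) = D⁴θ(y)[h,h,h,h]` (currency `D²(x ↦ D²θ(x)[a][b])(y)[c][d]`);
* `fourthDeriv_diag_nonpos_of_flatHotPoint` — the QUARTIC FORM IS SIGNED: `σ·D⁴θ(y)[h,h,h,h] ≤ 0` for EVERY `h ∈ ℝ³` (`…QuarticPin.quarticSign_of_flatHotPoint`);
* ★ `quarticForm_expansion_of_flatHotPoint` — for all `n z`: **`D⁴θ(y)[(nν+ze₂)⁴] = P n⁴ + 4B₃ n³z − 6μ₀P n²z² − 4μ₀B₃ nz³ + μ₀²P z⁴`** (multilinearity + Schwarz +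
  the normal form `…QuarticNormalForm.quarticNormalForm_of_flatHotPoint`), i.e. with `q = −σP/24`, `b = −σB₃/6`: `u`'s quartic part is `q[(n²+c₀z²)² + 4c₀z²n²] + b·zn(n²+c₀z²)`,
  and it is `≥ 0` as a form (`σ·(…) ≤ 0` for all `n, z`);
* ★ `oddQuartic_eq_zero_of_slope_zero` — **`μ₀ = 0 ⇒ B₃ = 0`** (memo §17e: «`Q_s = qn⁴ + bzn³` forces `b = 0`»): the sub-case `μ₀ = 0` has a PURE quartic `P n⁴`, no `z`-dependence at
  fourth order — sixth-order data decide there;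
* `abs_oddQuartic_le_of_form` — in general **`|B₃| ≤ √c₀·(−σP)`** (test vectors `(√c₀, ±1)`; an explicit instance of the memo's `|b| ≤ β₀√c₀ q`).
* ★ `abs_oddQuartic_le_of_flatHotPoint` — the same at every flat hot point of a `stub_T2bFlat` profile (data `μ₀, T, ν = JT` of `quarticForm_expansion_of_flatHotPoint`).

WHAT THIS IS NOT: not a claim about Navier–Stokes regularity and not a proof of `stub_T2bFlat`; fourth-order point structure for the OPEN flat sub-cell (bears_on LADDER-NS N0,
item 20428 / crux 19708; OPEN).
-/

set_option linter.style.longLine false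
set_option linter.dupNamespace false

namespace Summit.NavierStokesRegularity.NavierStokesRegularity.Theorems.PoloidalWindowDoorLrcModEntireTwistingTHFlatRidgeQuarticForm

open Set Function Filter Topology Metric
open scoped RealInnerProductSpace InnerProductSpace ContDiff
open Literature.Analysis Literature.Analysis.FluidPDE Literature.Analysis.UnboundedOperators
open Summit.NavierStokesRegularity.NavierStokesRegularity.Theorems
open Summit.NavierStokesRegularity.NavierStokesRegularity.Theorems.LocalSineTubeDoorProfileAlignedWindowRigidityAncient
open Summit.NavierStokesRegularity.NavierStokesRegularity.Theorems.PoloidalWindowDoorLrcModEntireRidgeWiring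
open Summit.NavierStokesRegularity.NavierStokesRegularity.Theorems.PoloidalWindowDoorLrcModEntireQuarticMax
open Summit.NavierStokesRegularity.NavierStokesRegularity.Theorems.PoloidalWindowDoorLrcModEntireTwistingTHFlatRidgeThirdJet
open Summit.NavierStokesRegularity.NavierStokesRegularity.Theorems.PoloidalWindowDoorLrcModEntireTwistingTHFlatRidgeQuarticLawTools
open Summit.NavierStokesRegularity.NavierStokesRegularity.Theorems.PoloidalWindowDoorLrcModEntireTwistingTHFlatRidgeQuarticPin
open Summit.NavierStokesRegularity.NavierStokesRegularity.Theorems.PoloidalWindowDoorLrcModEntireTwistingTHFlatRidgeSecantPin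
open Summit.NavierStokesRegularity.NavierStokesRegularity.Theorems.PoloidalWindowDoorLrcModEntireTwistingTHFlatRidgeQuarticNormalForm

/-! ### Class-free: the fourth line derivative, and multilinearity of the inner slots -/

section ClassFree

variable {E : Type*} [NormedAddCommGroup E] [NormedSpace ℝ E] {f : E → ℝ} {y : E}

/-- `(d⁴/ds⁴)|₀ f(y + sh) = D²(x ↦ D²f(x)[h][h])(y)[h][h]` for `f ∈ C⁴`. [folklore] -/
theorem iteratedDeriv_four_line_eq (hf : ContDiff ℝ 4 f) (y h : E) :
    iteratedDeriv 4 (fun s : ℝ => f (y + s • h)) 0 = fderiv ℝ (fderiv ℝ (fun x => fderiv ℝ (fderiv ℝ f) x h h)) y h h := by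
  have hf2 : ContDiff ℝ 2 f := hf.of_le (by norm_num)
  have hℓ2 : iteratedDeriv 2 (fun s : ℝ => f (y + s • h)) = fun s => fderiv ℝ (fderiv ℝ f) (y + s • h) h h := by
    funext s
    have hshift := congrFun (iteratedDeriv_comp_const_add 2 (fun s : ℝ => f (y + s • h)) s) 0
    rw [add_zero] at hshift
    rw [← hshift]
    have e : (fun z : ℝ => (fun s : ℝ => f (y + s • h)) (s + z)) = fun z : ℝ => f ((y + s • h) + z • h) := by
      funext z
      show f (y + (s + z) • h) = f (y + s • h + z • h)
      rw [add_smul, add_assoc]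
    rw [e, iteratedDeriv_two_line_apply hf2 (y + s • h) h]
  have e4 : iteratedDeriv 4 (fun s : ℝ => f (y + s • h)) 0 = iteratedDeriv 2 (iteratedDeriv 2 (fun s : ℝ => f (y + s • h))) 0 := by
    simp only [iteratedDeriv_eq_iterate]
    rw [show (4 : ℕ) = 2 + 2 from rfl, Function.iterate_add_apply]
  rw [e4, hℓ2, iteratedDeriv_two_line_apply (contDiff_hessianEntry hf h h) y h]

/-- Inner additivity: `D²(x ↦ D²f(x)[a + a'][b])(y) = D²(x ↦ D²f(x)[a][b])(y) + D²(x ↦ D²f(x)[a'][b])(y)`. [folklore] -/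
theorem fourthDeriv_inner_add (hf : ContDiff ℝ 4 f) (a a' b : E) :
    fderiv ℝ (fderiv ℝ (fun x => fderiv ℝ (fderiv ℝ f) x (a + a') b)) y =
      fderiv ℝ (fderiv ℝ (fun x => fderiv ℝ (fderiv ℝ f) x a b)) y + fderiv ℝ (fderiv ℝ (fun x => fderiv ℝ (fderiv ℝ f) x a' b)) y := by
  have ha := contDiff_hessianEntry hf a b
  have ha' := contDiff_hessianEntry hf a' b
  have e : (fun x => fderiv ℝ (fderiv ℝ f) x (a + a') b) = fun x => fderiv ℝ (fderiv ℝ f) x a b + fderiv ℝ (fderiv ℝ f) x a' b := by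
    funext x; simp only [map_add, add_apply]
  rw [e]
  have e1 : fderiv ℝ (fun x => fderiv ℝ (fderiv ℝ f) x a b + fderiv ℝ (fderiv ℝ f) x a' b) =
      fderiv ℝ (fun x => fderiv ℝ (fderiv ℝ f) x a b) + fderiv ℝ (fun x => fderiv ℝ (fderiv ℝ f) x a' b) := by
    funext x; exact fderiv_fun_add ((ha.differentiable (by norm_num)) x) ((ha'.differentiable (by norm_num)) x)
  rw [e1, fderiv_add (((ha.fderiv_right (m := 1) (by norm_num)).differentiable one_ne_zero) y)
    (((ha'.fderiv_right (m := 1) (by norm_num)).differentiable one_ne_zero) y)]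

/-- Inner homogeneity: `D²(x ↦ D²f(x)[c•a][b])(y) = c • D²(x ↦ D²f(x)[a][b])(y)`. [folklore] -/
theorem fourthDeriv_inner_smul (hf : ContDiff ℝ 4 f) (c : ℝ) (a b : E) :
    fderiv ℝ (fderiv ℝ (fun x => fderiv ℝ (fderiv ℝ f) x (c • a) b)) y = c • fderiv ℝ (fderiv ℝ (fun x => fderiv ℝ (fderiv ℝ f) x a b)) y := by
  have ha := contDiff_hessianEntry hf a b
  have e : (fun x => fderiv ℝ (fderiv ℝ f) x (c • a) b) = c • fun x => fderiv ℝ (fderiv ℝ f) x a b := by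
    funext x; simp only [map_smul, smul_apply, Pi.smul_apply, smul_eq_mul]
  rw [e]
  have e1 : fderiv ℝ (c • fun x => fderiv ℝ (fderiv ℝ f) x a b) = c • fderiv ℝ (fun x => fderiv ℝ (fderiv ℝ f) x a b) := by
    funext x; exact fderiv_const_smul ((ha.differentiable (by norm_num)) x) c
  rw [e1, fderiv_const_smul (((ha.fderiv_right (m := 1) (by norm_num)).differentiable one_ne_zero) y) c]

/-- **Expansion of the quartic form on a 2-plane** in the currency `T(c,d,a,b) := D²(x ↦ D²f(x)[a][b])(y)[c][d]`: with the five canonical components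
`P = T(ν,ν,ν,ν)`, `B = T(ν,w,ν,ν)`, `Cq = T(ν,ν,w,w)`, `D = T(ν,w,w,w)`, `Eq = T(w,w,w,w)`:
`T(h,h,h,h) = P n⁴ + 4B n³z + 6Cq n²z² + 4D nz³ + Eq z⁴` for `h = nν + zw`. [folklore] -/
theorem fourthDeriv_diag_expand (hf : ContDiff ℝ 4 f) (ν w : E) (n z : ℝ) :
    fderiv ℝ (fderiv ℝ (fun x => fderiv ℝ (fderiv ℝ f) x (n • ν + z • w) (n • ν + z • w))) y (n • ν + z • w) (n • ν + z • w) =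
      fderiv ℝ (fderiv ℝ (fun x => fderiv ℝ (fderiv ℝ f) x ν ν)) y ν ν * n ^ 4 +
        4 * fderiv ℝ (fderiv ℝ (fun x => fderiv ℝ (fderiv ℝ f) x ν ν)) y ν w * (n ^ 3 * z) +
        6 * fderiv ℝ (fderiv ℝ (fun x => fderiv ℝ (fderiv ℝ f) x w w)) y ν ν * (n ^ 2 * z ^ 2) +
        4 * fderiv ℝ (fderiv ℝ (fun x => fderiv ℝ (fderiv ℝ f) x w w)) y ν w * (n * z ^ 3) +
        fderiv ℝ (fderiv ℝ (fun x => fderiv ℝ (fderiv ℝ f) x w w)) y w w * z ^ 4 := by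
  -- inner expansion
  have hin : fderiv ℝ (fderiv ℝ (fun x => fderiv ℝ (fderiv ℝ f) x (n • ν + z • w) (n • ν + z • w))) y =
      (n * n) • fderiv ℝ (fderiv ℝ (fun x => fderiv ℝ (fderiv ℝ f) x ν ν)) y + (n * z) • fderiv ℝ (fderiv ℝ (fun x => fderiv ℝ (fderiv ℝ f) x ν w)) y +
        ((z * n) • fderiv ℝ (fderiv ℝ (fun x => fderiv ℝ (fderiv ℝ f) x ν w)) y + (z * z) • fderiv ℝ (fderiv ℝ (fun x => fderiv ℝ (fderiv ℝ f) x w w)) y) := by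
    rw [fourthDeriv_inner_add hf, fourthDeriv_inner_smul hf, fourthDeriv_inner_smul hf,
      fourthDeriv_symm_inner hf ν (n • ν + z • w), fourthDeriv_symm_inner hf w (n • ν + z • w),
      fourthDeriv_inner_add hf, fourthDeriv_inner_smul hf, fourthDeriv_inner_smul hf,
      fourthDeriv_inner_add hf, fourthDeriv_inner_smul hf, fourthDeriv_inner_smul hf,
      fourthDeriv_symm_inner hf w ν]
    simp only [smul_add, smul_smul]
  rw [hin]
  simp only [add_apply, smul_apply, map_add, map_smul, smul_eq_mul]
  -- outer symmetries and the middle swap to canonical components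
  have s1 : fderiv ℝ (fderiv ℝ (fun x => fderiv ℝ (fderiv ℝ f) x ν ν)) y w ν = fderiv ℝ (fderiv ℝ (fun x => fderiv ℝ (fderiv ℝ f) x ν ν)) y ν w :=
    fourthDeriv_symm_outer hf ν ν w ν
  have s2 : fderiv ℝ (fderiv ℝ (fun x => fderiv ℝ (fderiv ℝ f) x ν w)) y ν ν = fderiv ℝ (fderiv ℝ (fun x => fderiv ℝ (fderiv ℝ f) x ν ν)) y ν w := by
    rw [fourthDeriv_symm_inner hf ν w]; exact fourthDeriv_symm_middle hf w ν ν ν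
  have s3 : fderiv ℝ (fderiv ℝ (fun x => fderiv ℝ (fderiv ℝ f) x ν w)) y ν w = fderiv ℝ (fderiv ℝ (fun x => fderiv ℝ (fderiv ℝ f) x w w)) y ν ν := by
    rw [fourthDeriv_symm_middle hf ν w ν w]
  have s4 : fderiv ℝ (fderiv ℝ (fun x => fderiv ℝ (fderiv ℝ f) x ν w)) y w ν = fderiv ℝ (fderiv ℝ (fun x => fderiv ℝ (fderiv ℝ f) x w w)) y ν ν := by
    rw [fourthDeriv_symm_outer hf ν w w ν]; exact fourthDeriv_symm_middle hf ν w ν w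
  have s5 : fderiv ℝ (fderiv ℝ (fun x => fderiv ℝ (fderiv ℝ f) x ν w)) y w w = fderiv ℝ (fderiv ℝ (fun x => fderiv ℝ (fderiv ℝ f) x w w)) y ν w := by
    rw [fourthDeriv_symm_middle hf ν w w w]; exact fourthDeriv_symm_outer hf w w w ν
  have s6 : fderiv ℝ (fderiv ℝ (fun x => fderiv ℝ (fderiv ℝ f) x w w)) y w ν = fderiv ℝ (fderiv ℝ (fun x => fderiv ℝ (fderiv ℝ f) x w w)) y ν w :=
    fourthDeriv_symm_outer hf w w w ν
  have s7 : fderiv ℝ (fderiv ℝ (fun x => fderiv ℝ (fderiv ℝ f) x ν ν)) y w w = fderiv ℝ (fderiv ℝ (fun x => fderiv ℝ (fderiv ℝ f) x w w)) y ν ν := by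
    rw [fourthDeriv_symm_middle hf ν ν w w, fourthDeriv_symm_outer hf w ν w ν, fourthDeriv_symm_inner hf w ν]
    exact fourthDeriv_symm_middle hf ν w ν w
  rw [s1, s2, s3, s4, s5, s6, s7]
  ring

end ClassFree

variable {C : ℝ} {v : ℝ → EuclideanSpace ℝ (Fin 3) → EuclideanSpace ℝ (Fin 3)}

/-- **THE QUARTIC FORM IS SIGNED at a flat hot point:** `σ·D⁴θ(y)[h,h,h,h] ≤ 0` for EVERY `h ∈ ℝ³` (the line form of `…QuarticPin.quarticSign_of_flatHotPoint`). -/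
theorem fourthDeriv_diag_nonpos_of_flatHotPoint (hdec : HasTypeITimeDecay C v) (hcont : ContinuousOn (uncurry v) (Iio (0 : ℝ) ×ˢ univ))
    (hmild : ∀ s t : ℝ, s < t → t < 0 → ∀ x, v t x = heatExtension (v s) (t - s) x - oseenDuhamel 1 s v v t x)
    (hdiv : ∀ t < 0, VectorCalculus.IsDivFree (v t))
    (hTH : ∀ t < 0, ∀ x x' : EuclideanSpace ℝ (Fin 3), x 2 = x' 2 → ∀ b c : Fin 3, b ≠ 2 → c ≠ 2 →
      fderiv ℝ (v t) x (EuclideanSpace.single 2 1) b * fderiv ℝ (v t) x' (EuclideanSpace.single c 1) 2 =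
        fderiv ℝ (v t) x' (EuclideanSpace.single 2 1) c * fderiv ℝ (v t) x (EuclideanSpace.single b 1) 2)
    (hne : v (-1) 0 2 ≠ 0) (hhot : ∀ t < 0, ∀ x, Real.sqrt (-t) * |v t x 2| ≤ |v (-1) 0 2|)
    (hproper : ∀ y ∈ {y : EuclideanSpace ℝ (Fin 3) | y 2 = 0 ∧ v (-1) y 2 = v (-1) 0 2}, ∀ r : ℝ, 0 < r →
      ∃ y' : EuclideanSpace ℝ (Fin 3), y' 2 = 0 ∧ dist y' y < r ∧ v (-1) y' 2 ≠ v (-1) 0 2)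
    {σ : ℝ} (hσN : σ * v (-1) 0 2 = |v (-1) 0 2|)
    {y : EuclideanSpace ℝ (Fin 3)} (hy0 : y 2 = 0) (hy : v (-1) y 2 = v (-1) 0 2)
    (hflat : fderiv ℝ (fderiv ℝ (fun x => σ * v (-1) x 2)) y (EuclideanSpace.single 0 1) (EuclideanSpace.single 0 1) +
      fderiv ℝ (fderiv ℝ (fun x => σ * v (-1) x 2)) y (EuclideanSpace.single 1 1) (EuclideanSpace.single 1 1) = 0)
    (h : EuclideanSpace ℝ (Fin 3)) :
    σ * fderiv ℝ (fderiv ℝ (fun x => fderiv ℝ (fderiv ℝ (fun x' => (v (-1) x' 2 : ℝ))) x h h)) y h h ≤ 0 := by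
  have hθ : ContDiff ℝ 4 (fun x' => (v (-1) x' 2 : ℝ)) := contDiff_two_component hdec hcont hmild
  rw [← iteratedDeriv_four_line_eq hθ y h]
  exact quarticSign_of_flatHotPoint hdec hcont hmild hdiv hTH hne hhot hproper hσN hy0 hy hflat h

/-- ★ **THE TRANSVERSAL BINARY QUARTIC FORM at a flat hot point, explicit and signed.**  With `μ₀ ≤ 0`, the secant direction `T`, `ν = JT` of
`…QuarticNormalForm.quarticNormalForm_of_flatHotPoint`, `P := D⁴θ(y)[ν,ν,ν,ν]`, `B₃ := D⁴θ(y)[ν,e₂,ν,ν]`: for all `n z`,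
`D⁴θ(y)[(nν+ze₂)⁴] = P n⁴ + 4B₃ n³z − 6μ₀P n²z² − 4μ₀B₃ nz³ + μ₀²P z⁴` and `σ·(that) ≤ 0`. -/
theorem quarticForm_expansion_of_flatHotPoint (hdec : HasTypeITimeDecay C v) (hcont : ContinuousOn (uncurry v) (Iio (0 : ℝ) ×ˢ univ))
    (hmild : ∀ s t : ℝ, s < t → t < 0 → ∀ x, v t x = heatExtension (v s) (t - s) x - oseenDuhamel 1 s v v t x)
    (hdiv : ∀ t < 0, VectorCalculus.IsDivFree (v t))
    (hpol : ∀ s < 0, ∀ y, ⟪curl (v s) y, EuclideanSpace.single 2 1⟫_ℝ = 0)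
    (hTH : ∀ t < 0, ∀ x x' : EuclideanSpace ℝ (Fin 3), x 2 = x' 2 → ∀ b c : Fin 3, b ≠ 2 → c ≠ 2 →
      fderiv ℝ (v t) x (EuclideanSpace.single 2 1) b * fderiv ℝ (v t) x' (EuclideanSpace.single c 1) 2 =
        fderiv ℝ (v t) x' (EuclideanSpace.single 2 1) c * fderiv ℝ (v t) x (EuclideanSpace.single b 1) 2)
    (hne : v (-1) 0 2 ≠ 0) (hhot : ∀ t < 0, ∀ x, Real.sqrt (-t) * |v t x 2| ≤ |v (-1) 0 2|)
    (hproper : ∀ y ∈ {y : EuclideanSpace ℝ (Fin 3) | y 2 = 0 ∧ v (-1) y 2 = v (-1) 0 2}, ∀ r : ℝ, 0 < r →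
      ∃ y' : EuclideanSpace ℝ (Fin 3), y' 2 = 0 ∧ dist y' y < r ∧ v (-1) y' 2 ≠ v (-1) 0 2)
    (hni : ∀ K O : Set (EuclideanSpace ℝ (Fin 3)), IsCompact K → K.Nonempty → K ⊆ {y : EuclideanSpace ℝ (Fin 3) | y 2 = 0 ∧ v (-1) y 2 = v (-1) 0 2} →
      IsOpen O → K ⊆ O → O ∩ {y : EuclideanSpace ℝ (Fin 3) | y 2 = 0 ∧ v (-1) y 2 = v (-1) 0 2} ⊆ K → False)
    {σ : ℝ} (hσN : σ * v (-1) 0 2 = |v (-1) 0 2|)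
    (hflatAll : ∀ y : EuclideanSpace ℝ (Fin 3), y 2 = 0 → v (-1) y 2 = v (-1) 0 2 →
      fderiv ℝ (fderiv ℝ (fun x => σ * v (-1) x 2)) y (EuclideanSpace.single 0 1) (EuclideanSpace.single 0 1) +
        fderiv ℝ (fderiv ℝ (fun x => σ * v (-1) x 2)) y (EuclideanSpace.single 1 1) (EuclideanSpace.single 1 1) = 0)
    {y : EuclideanSpace ℝ (Fin 3)} (hy0 : y 2 = 0) (hy : v (-1) y 2 = v (-1) 0 2) :
    ∃ μ₀ : ℝ, μ₀ ≤ 0 ∧ ∃ T : EuclideanSpace ℝ (Fin 3), T 2 = 0 ∧ ‖T‖ = 1 ∧ ∀ n z : ℝ,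
      fderiv ℝ (fderiv ℝ (fun x => fderiv ℝ (fderiv ℝ (fun x' => (v (-1) x' 2 : ℝ))) x
          (n • ((-T 1) • EuclideanSpace.single 0 (1 : ℝ) + T 0 • EuclideanSpace.single 1 (1 : ℝ)) + z • EuclideanSpace.single 2 (1 : ℝ))
          (n • ((-T 1) • EuclideanSpace.single 0 (1 : ℝ) + T 0 • EuclideanSpace.single 1 (1 : ℝ)) + z • EuclideanSpace.single 2 (1 : ℝ)))) y
          (n • ((-T 1) • EuclideanSpace.single 0 (1 : ℝ) + T 0 • EuclideanSpace.single 1 (1 : ℝ)) + z • EuclideanSpace.single 2 (1 : ℝ))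
          (n • ((-T 1) • EuclideanSpace.single 0 (1 : ℝ) + T 0 • EuclideanSpace.single 1 (1 : ℝ)) + z • EuclideanSpace.single 2 (1 : ℝ)) =
        fderiv ℝ (fderiv ℝ (fun x => fderiv ℝ (fderiv ℝ (fun x' => (v (-1) x' 2 : ℝ))) x
            ((-T 1) • EuclideanSpace.single 0 (1 : ℝ) + T 0 • EuclideanSpace.single 1 (1 : ℝ)) ((-T 1) • EuclideanSpace.single 0 (1 : ℝ) + T 0 • EuclideanSpace.single 1 (1 : ℝ)))) y
            ((-T 1) • EuclideanSpace.single 0 (1 : ℝ) + T 0 • EuclideanSpace.single 1 (1 : ℝ)) ((-T 1) • EuclideanSpace.single 0 (1 : ℝ) + T 0 • EuclideanSpace.single 1 (1 : ℝ)) *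
            (n ^ 4 - 6 * μ₀ * (n ^ 2 * z ^ 2) + μ₀ ^ 2 * z ^ 4) +
          fderiv ℝ (fderiv ℝ (fun x => fderiv ℝ (fderiv ℝ (fun x' => (v (-1) x' 2 : ℝ))) x
            ((-T 1) • EuclideanSpace.single 0 (1 : ℝ) + T 0 • EuclideanSpace.single 1 (1 : ℝ)) ((-T 1) • EuclideanSpace.single 0 (1 : ℝ) + T 0 • EuclideanSpace.single 1 (1 : ℝ)))) y
            ((-T 1) • EuclideanSpace.single 0 (1 : ℝ) + T 0 • EuclideanSpace.single 1 (1 : ℝ)) (EuclideanSpace.single 2 1) *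
            (4 * (n ^ 3 * z) - 4 * μ₀ * (n * z ^ 3)) ∧
      σ * (fderiv ℝ (fderiv ℝ (fun x => fderiv ℝ (fderiv ℝ (fun x' => (v (-1) x' 2 : ℝ))) x
            ((-T 1) • EuclideanSpace.single 0 (1 : ℝ) + T 0 • EuclideanSpace.single 1 (1 : ℝ)) ((-T 1) • EuclideanSpace.single 0 (1 : ℝ) + T 0 • EuclideanSpace.single 1 (1 : ℝ)))) y
            ((-T 1) • EuclideanSpace.single 0 (1 : ℝ) + T 0 • EuclideanSpace.single 1 (1 : ℝ)) ((-T 1) • EuclideanSpace.single 0 (1 : ℝ) + T 0 • EuclideanSpace.single 1 (1 : ℝ)) *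
            (n ^ 4 - 6 * μ₀ * (n ^ 2 * z ^ 2) + μ₀ ^ 2 * z ^ 4) +
          fderiv ℝ (fderiv ℝ (fun x => fderiv ℝ (fderiv ℝ (fun x' => (v (-1) x' 2 : ℝ))) x
            ((-T 1) • EuclideanSpace.single 0 (1 : ℝ) + T 0 • EuclideanSpace.single 1 (1 : ℝ)) ((-T 1) • EuclideanSpace.single 0 (1 : ℝ) + T 0 • EuclideanSpace.single 1 (1 : ℝ)))) y
            ((-T 1) • EuclideanSpace.single 0 (1 : ℝ) + T 0 • EuclideanSpace.single 1 (1 : ℝ)) (EuclideanSpace.single 2 1) *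
            (4 * (n ^ 3 * z) - 4 * μ₀ * (n * z ^ 3))) ≤ 0 := by
  have hθ : ContDiff ℝ 4 (fun x' => (v (-1) x' 2 : ℝ)) := contDiff_two_component hdec hcont hmild
  have hflat := hflatAll y hy0 hy
  obtain ⟨μ₀, hμ0, T, hT2, hT1, hker, hii, hiii⟩ :=
    quarticNormalForm_of_flatHotPoint hdec hcont hmild hdiv hpol hTH hne hhot hproper hni hσN hflatAll hy0 hy
  refine ⟨μ₀, hμ0, T, hT2, hT1, fun n z => ?_⟩
  set θ : EuclideanSpace ℝ (Fin 3) → ℝ := fun x' => v (-1) x' 2 with hθdef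
  set ν : EuclideanSpace ℝ (Fin 3) := (-T 1) • EuclideanSpace.single 0 (1 : ℝ) + T 0 • EuclideanSpace.single 1 (1 : ℝ) with hνdef
  set e₂ : EuclideanSpace ℝ (Fin 3) := EuclideanSpace.single 2 1 with he₂
  have hexp := fourthDeriv_diag_expand (y := y) hθ ν e₂ n z
  -- normal form substitutions
  have hC : fderiv ℝ (fderiv ℝ (fun x => fderiv ℝ (fderiv ℝ θ) x e₂ e₂)) y ν ν = (-μ₀) * fderiv ℝ (fderiv ℝ (fun x => fderiv ℝ (fderiv ℝ θ) x ν ν)) y ν ν :=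
    hii ν ν
  have hD : fderiv ℝ (fderiv ℝ (fun x => fderiv ℝ (fderiv ℝ θ) x e₂ e₂)) y ν e₂ = (-μ₀) * fderiv ℝ (fderiv ℝ (fun x => fderiv ℝ (fderiv ℝ θ) x ν ν)) y ν e₂ :=
    hii ν e₂
  have hexp' : fderiv ℝ (fderiv ℝ (fun x => fderiv ℝ (fderiv ℝ θ) x (n • ν + z • e₂) (n • ν + z • e₂))) y (n • ν + z • e₂) (n • ν + z • e₂) =
      fderiv ℝ (fderiv ℝ (fun x => fderiv ℝ (fderiv ℝ θ) x ν ν)) y ν ν * (n ^ 4 - 6 * μ₀ * (n ^ 2 * z ^ 2) + μ₀ ^ 2 * z ^ 4) +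
        fderiv ℝ (fderiv ℝ (fun x => fderiv ℝ (fderiv ℝ θ) x ν ν)) y ν e₂ * (4 * (n ^ 3 * z) - 4 * μ₀ * (n * z ^ 3)) := by
    rw [hexp, hC, hD, hiii]
    ring
  refine ⟨hexp', ?_⟩
  rw [← hexp']
  exact fourthDeriv_diag_nonpos_of_flatHotPoint hdec hcont hmild hdiv hTH hne hhot hproper hσN hy0 hy hflat (n • ν + z • e₂)

/-- ★ **`μ₀ = 0 ⇒ B₃ = 0` (memo T2B-g15 §17e).**  If a signed binary quartic `σ·(P(n⁴ − 6μ₀n²z² + μ₀²z⁴) + B₃(4n³z − 4μ₀nz³)) ≤ 0` for all `n z` has `μ₀ = 0`, then its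
odd coefficient vanishes: `B₃ = 0` (pure `σP n⁴ ≤ 0`; at such a flat hot point sixth-order data decide). [folklore] -/
theorem oddQuartic_eq_zero_of_slope_zero {σ P B₃ μ₀ : ℝ} (hσ : σ = 1 ∨ σ = -1) (hμ : μ₀ = 0)
    (hform : ∀ n z : ℝ, σ * (P * (n ^ 4 - 6 * μ₀ * (n ^ 2 * z ^ 2) + μ₀ ^ 2 * z ^ 4) + B₃ * (4 * (n ^ 3 * z) - 4 * μ₀ * (n * z ^ 3))) ≤ 0) :
    B₃ = 0 := by
  subst hμ
  by_contra hB
  have hσ2 : σ ^ 2 = 1 := by rcases hσ with h | h <;> simp [h]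
  have h1 := hform 1 (σ * (|P| + 1) / (4 * B₃))
  have e : σ * (P * ((1 : ℝ) ^ 4 - 6 * 0 * ((1 : ℝ) ^ 2 * (σ * (|P| + 1) / (4 * B₃)) ^ 2) + (0 : ℝ) ^ 2 * (σ * (|P| + 1) / (4 * B₃)) ^ 4) +
      B₃ * (4 * ((1 : ℝ) ^ 3 * (σ * (|P| + 1) / (4 * B₃))) - 4 * 0 * (1 * (σ * (|P| + 1) / (4 * B₃)) ^ 3))) = σ * P + σ ^ 2 * (|P| + 1) := by
    field_simp
    ring
  rw [e, hσ2, one_mul] at h1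
  have hσP : -|P| ≤ σ * P := by
    rcases hσ with h | h
    · rw [h, one_mul]; exact neg_abs_le P
    · rw [h, neg_one_mul, neg_le_neg_iff]; exact le_abs_self P
  linarith


/-- ★ **THE ODD COEFFICIENT IS DOMINATED: `|B₃| ≤ √c₀·(−σP)`** (`c₀ = −μ₀ ≥ 0`; memo T2B-g15 §17b «PSD ⟺ |b| ≤ β₀√c₀ q», here with the explicit sufficient constant from the
test vectors `(n,z) = (√c₀, ±1)`; for `μ₀ = 0` it is `B₃ = 0` again). [folklore] -/
theorem abs_oddQuartic_le_of_form {σ P B₃ μ₀ : ℝ} (hσ : σ = 1 ∨ σ = -1) (hμ : μ₀ ≤ 0)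
    (hform : ∀ n z : ℝ, σ * (P * (n ^ 4 - 6 * μ₀ * (n ^ 2 * z ^ 2) + μ₀ ^ 2 * z ^ 4) + B₃ * (4 * (n ^ 3 * z) - 4 * μ₀ * (n * z ^ 3))) ≤ 0) :
    |B₃| ≤ Real.sqrt (-μ₀) * (-(σ * P)) := by
  rcases eq_or_lt_of_le hμ with h0 | hneg
  · have hB := oddQuartic_eq_zero_of_slope_zero hσ h0 hform
    rw [hB, h0, neg_zero, Real.sqrt_zero, zero_mul, abs_zero]
  · set s : ℝ := Real.sqrt (-μ₀) with hs
    have hs2 : s ^ 2 = -μ₀ := by rw [hs, Real.sq_sqrt (by linarith)]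
    have hspos : 0 < s := Real.sqrt_pos.2 (by linarith)
    have h1 := hform s 1
    have h2 := hform s (-1)
    have e1 : σ * (P * (s ^ 4 - 6 * μ₀ * (s ^ 2 * (1 : ℝ) ^ 2) + μ₀ ^ 2 * (1 : ℝ) ^ 4) + B₃ * (4 * (s ^ 3 * 1) - 4 * μ₀ * (s * (1 : ℝ) ^ 3))) =
        8 * μ₀ ^ 2 * (σ * P) - 8 * μ₀ * s * (σ * B₃) := by
      have : s ^ 4 = μ₀ ^ 2 := by nlinarith [hs2]
      have h3 : s ^ 3 = -μ₀ * s := by nlinarith [hs2]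
      rw [this, h3, hs2]; ring
    have e2 : σ * (P * (s ^ 4 - 6 * μ₀ * (s ^ 2 * (-1 : ℝ) ^ 2) + μ₀ ^ 2 * (-1 : ℝ) ^ 4) + B₃ * (4 * (s ^ 3 * (-1)) - 4 * μ₀ * (s * (-1 : ℝ) ^ 3))) =
        8 * μ₀ ^ 2 * (σ * P) + 8 * μ₀ * s * (σ * B₃) := by
      have : s ^ 4 = μ₀ ^ 2 := by nlinarith [hs2]
      have h3 : s ^ 3 = -μ₀ * s := by nlinarith [hs2]
      rw [this, h3, hs2]; ring
    rw [e1] at h1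
    rw [e2] at h2
    -- divide by `−8μ₀ > 0`: `∓ s σB₃ ≤ μ₀ σP`... i.e. `s|σB₃| ≤ (−μ₀)(−σP)`
    have hμpos : 0 < -μ₀ := by linarith
    have k1 : s * (σ * B₃) ≤ -μ₀ * (-(σ * P)) := by nlinarith
    have k2 : -(s * (σ * B₃)) ≤ -μ₀ * (-(σ * P)) := by nlinarith
    have habs : s * |σ * B₃| ≤ -μ₀ * (-(σ * P)) := by
      rcases le_or_gt 0 (σ * B₃) with h | h
      · rw [abs_of_nonneg h]; exact k1
      · rw [abs_of_neg h]; linarith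
    have hσabs : |σ| = 1 := by rcases hσ with h | h <;> simp [h]
    rw [abs_mul, hσabs, one_mul] at habs
    -- `s|B₃| ≤ s²(−σP)` ⇒ `|B₃| ≤ s(−σP)`
    rw [← hs2] at habs
    have : s * |B₃| ≤ s * (s * (-(σ * P))) := by nlinarith
    exact le_of_mul_le_mul_left this hspos

/-- ★ **`|B₃| ≤ √c₀·(−σP)` at every flat hot point** (`P = ∂_ν⁴θ(y)`, `B₃ = D⁴θ(y)[ν,e₂,ν,ν]`, `c₀ = −μ₀`; data of `…QuarticForm.quarticForm_expansion_of_flatHotPoint`). -/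
theorem abs_oddQuartic_le_of_flatHotPoint (hdec : HasTypeITimeDecay C v) (hcont : ContinuousOn (uncurry v) (Iio (0 : ℝ) ×ˢ univ))
    (hmild : ∀ s t : ℝ, s < t → t < 0 → ∀ x, v t x = heatExtension (v s) (t - s) x - oseenDuhamel 1 s v v t x)
    (hdiv : ∀ t < 0, VectorCalculus.IsDivFree (v t))
    (hpol : ∀ s < 0, ∀ y, ⟪curl (v s) y, EuclideanSpace.single 2 1⟫_ℝ = 0)
    (hTH : ∀ t < 0, ∀ x x' : EuclideanSpace ℝ (Fin 3), x 2 = x' 2 → ∀ b c : Fin 3, b ≠ 2 → c ≠ 2 →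
      fderiv ℝ (v t) x (EuclideanSpace.single 2 1) b * fderiv ℝ (v t) x' (EuclideanSpace.single c 1) 2 =
        fderiv ℝ (v t) x' (EuclideanSpace.single 2 1) c * fderiv ℝ (v t) x (EuclideanSpace.single b 1) 2)
    (hne : v (-1) 0 2 ≠ 0) (hhot : ∀ t < 0, ∀ x, Real.sqrt (-t) * |v t x 2| ≤ |v (-1) 0 2|)
    (hproper : ∀ y ∈ {y : EuclideanSpace ℝ (Fin 3) | y 2 = 0 ∧ v (-1) y 2 = v (-1) 0 2}, ∀ r : ℝ, 0 < r →
      ∃ y' : EuclideanSpace ℝ (Fin 3), y' 2 = 0 ∧ dist y' y < r ∧ v (-1) y' 2 ≠ v (-1) 0 2)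
    (hni : ∀ K O : Set (EuclideanSpace ℝ (Fin 3)), IsCompact K → K.Nonempty → K ⊆ {y : EuclideanSpace ℝ (Fin 3) | y 2 = 0 ∧ v (-1) y 2 = v (-1) 0 2} →
      IsOpen O → K ⊆ O → O ∩ {y : EuclideanSpace ℝ (Fin 3) | y 2 = 0 ∧ v (-1) y 2 = v (-1) 0 2} ⊆ K → False)
    {σ : ℝ} (hσ : σ = 1 ∨ σ = -1) (hσN : σ * v (-1) 0 2 = |v (-1) 0 2|)
    (hflatAll : ∀ y : EuclideanSpace ℝ (Fin 3), y 2 = 0 → v (-1) y 2 = v (-1) 0 2 →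
      fderiv ℝ (fderiv ℝ (fun x => σ * v (-1) x 2)) y (EuclideanSpace.single 0 1) (EuclideanSpace.single 0 1) +
        fderiv ℝ (fderiv ℝ (fun x => σ * v (-1) x 2)) y (EuclideanSpace.single 1 1) (EuclideanSpace.single 1 1) = 0)
    {y : EuclideanSpace ℝ (Fin 3)} (hy0 : y 2 = 0) (hy : v (-1) y 2 = v (-1) 0 2) :
    ∃ μ₀ : ℝ, μ₀ ≤ 0 ∧ ∃ T : EuclideanSpace ℝ (Fin 3), T 2 = 0 ∧ ‖T‖ = 1 ∧
      |fderiv ℝ (fderiv ℝ (fun x => fderiv ℝ (fderiv ℝ (fun x' => (v (-1) x' 2 : ℝ))) x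
          ((-T 1) • EuclideanSpace.single 0 (1 : ℝ) + T 0 • EuclideanSpace.single 1 (1 : ℝ)) ((-T 1) • EuclideanSpace.single 0 (1 : ℝ) + T 0 • EuclideanSpace.single 1 (1 : ℝ)))) y
          ((-T 1) • EuclideanSpace.single 0 (1 : ℝ) + T 0 • EuclideanSpace.single 1 (1 : ℝ)) (EuclideanSpace.single 2 1)| ≤
        Real.sqrt (-μ₀) * (-(σ * fderiv ℝ (fderiv ℝ (fun x => fderiv ℝ (fderiv ℝ (fun x' => (v (-1) x' 2 : ℝ))) x
          ((-T 1) • EuclideanSpace.single 0 (1 : ℝ) + T 0 • EuclideanSpace.single 1 (1 : ℝ)) ((-T 1) • EuclideanSpace.single 0 (1 : ℝ) + T 0 • EuclideanSpace.single 1 (1 : ℝ)))) y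
          ((-T 1) • EuclideanSpace.single 0 (1 : ℝ) + T 0 • EuclideanSpace.single 1 (1 : ℝ)) ((-T 1) • EuclideanSpace.single 0 (1 : ℝ) + T 0 • EuclideanSpace.single 1 (1 : ℝ)))) := by
  obtain ⟨μ₀, hμ0, T, hT2, hT1, hform⟩ := quarticForm_expansion_of_flatHotPoint hdec hcont hmild hdiv hpol hTH hne hhot hproper hni hσN hflatAll hy0 hy
  exact ⟨μ₀, hμ0, T, hT2, hT1, abs_oddQuartic_le_of_form hσ hμ0 fun n z => (hform n z).2⟩

end Summit.NavierStokesRegularity.NavierStokesRegularity.Theorems.PoloidalWindowDoorLrcModEntireTwistingTHFlatRidgeQuarticForm
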